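import Summits.HodgeConjecture.HodgeConjecture.Theorems.F0P3CotangentFormValueMap
import Mathlib.Analysis.Calculus.Deriv.Star
import HarnessLib

/-!
# FLOOR-0 P3 — rung-1 brick B1′ (antiholomorphic twin): the VALUE MAP OF AN ANTIHOLOMORPHIC COTANGENT FORM `Φ̄ = conjFun Φ`
# in `P.archModuleCM` is a typed null value map OF TYPE `−1`

Cell hodgecm-mathlib, FLOOR 0, crux item H413 = stmt-HodgeConjecture-24833; brief B1′ of the P3 integrator (F0P3-plan (g0)
2026-08-31T00:17:32Z: «antihol twin δ = −1 via ★ `conjFun`»), author F0P3-p01 (g3).  PROOF lane (no `def`, no instance, no named fact).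
The second INSTANCE of the generic §1–§3 of ★ `F0P3CotangentFormValueMap` (the first being its §4, the holomorphic case).

For a holomorphic cotangent form `Φ ∈ holCotForms` of the CM frame and its componentwise conjugate `Φ̄ = conjFun Φ` (an
antiholomorphic cotangent form, ★ `UnitaryGroupCohomologicalForms` §1; `P.IsAntiholCotangentAt` quantifies over exactly these):
* §1 the CONJUGATE SPAN `S(Φ̄)`: `X (star ∘ ψ) = star ∘ X ψ` (`lieDeriv_star`, Mathlib `deriv.star`), hence the iterated Lie derivatives of
  the coordinates of `Φ̄` are the conjugates of those of `Φ` (`iterLieDeriv_conjFun`) and `S(Φ̄)` is an `L²`-LIE-STABLE space for the local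
  datum `(u21Group, cmArchSection)` (`isL2LieStable_span_conj`, from the hol package ★ `F0P2aL2bHolLieSpanPackage`);
* §2 the CONJUGATE cotangent `K`-type `Φ̄ (x · ι_∞ k) j = ∑ᵢ conj(conj(k₂₂) kᵢⱼ) · Φ̄ x i` (`apply_mul_cmArchSectionUForm_K_conj`) and the
  ANTI-Cauchy–Riemann relations `X_{ib} Φ̄ⱼ = −i · X_b Φ̄ⱼ` (`lieDeriv_liePMat_I_smul_antihol`);
* §3 `exists_vectors_antihol` (the classes `wⱼ = [Φ̄ⱼ] ∈ P.archModuleCM ι T hT`) and HEAD **`valueMap_antihol`**: for the CONJUGATE-LINEAR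
  value map `φ(Y) = ∑ⱼ conj(Y_{(inl j)(inr 0)}) • wⱼ` (★ `exists_valueMap` with `χ = conj`) the five binders (h0)(hK)(h𝔨)(hwt)(hN) of a typed null
  value map OF TYPE `−1` for `(P.archRepKCM ι T hT, P.archRepLieCM ι T hT)` hold — token for token the `φm` binders `hm0 … hmN` of ★
  `F0P3ValueMapTransport.not_both_types_of_detected` — and `Φ̄ ≠ 0 → φ ≠ 0` (algebra ★ `F0P3ValueMapOfFrameVectors.valueMap_antihol`).

References: Borel–Wallach 2000, II §4.1–4.2, VI 4.8, VII 2.10 (conjugation exchanges the `(1,0)` and `(0,1)` forms) [BorelWallach2000];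
Borel 1997, §5.14 [Borel1997]; Rogawski 1990, Prop. 15.2.1 (b) (`J⁻`) [Rogawski1990]; Borel–Jacquet 1979, §4.6 [BorelJacquetCorvallis1979].
HONEST LABEL: HC_CM is proved only modulo the printed citations until rung 0 closes; this file discharges none of them.
-/

-- Mathlib idiom (as in ★ `GKModules` and every `(𝔤, K)` file of the tree): commutator bracket on `Module.End` / matrices
attribute [local instance 100] LieRing.ofAssociativeRing

-- The scoped `L^∞`-operator normed structure on matrices agrees with the product topology only up to non-reducible
-- unfolding (cf. `Matrix.exp_add_of_commute` in Mathlib and ★ `GKModulesSmoothVectorsProofs`).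
set_option backward.isDefEq.respectTransparency false

set_option autoImplicit false
set_option linter.dupNamespace false

noncomputable section

open scoped Matrix MatrixGroups ComplexConjugate ENNReal
open NumberField MeasureTheory MulAction

namespace Summit.HodgeConjecture.HodgeConjecture.Cruxes.H413.F0P3CotangentFormValueMapAntihol

open Literature.NumberTheory.Automorphic Literature.NumberTheory.Automorphic.UnitaryGroup
open Literature.NumberTheory.Automorphic.UnitaryGroup.CotangentForms
open Literature.RepresentationTheory.KonnoKonno2007 Literature.RepresentationTheory.KonnoKonno2007.RealDualPair
open Literature.RepresentationTheory.BorelWallach2000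
open Literature.Geometry.ComplexHyperbolic.BallModel (U21 J)
open Literature.AlgebraicGeometry.ShimuraVarieties.BallForms (u21Group liePMat)
open Summit.HodgeConjecture.HodgeConjecture.Cruxes.H413.F0P2aL2bHolLieSpanPackage
open Summit.HodgeConjecture.HodgeConjecture.Cruxes.H413.F0P3CMFrameOrbit
open Summit.HodgeConjecture.HodgeConjecture.Cruxes.H413.F0P3ValueMapOfFrameVectors
open Summit.HodgeConjecture.HodgeConjecture.Cruxes.H413.F0P3CotangentFormL2Span
open Summit.HodgeConjecture.HodgeConjecture.Cruxes.H413.F0P3CotangentFormValueMap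

/-! ## §1 Conjugation and Lie derivatives; the conjugate span `S(Φ̄)` -/

section Star

variable {GU : Type*} [Group GU] (ιU : u21Group.carrier →* GU)

/-- **`X (ψ̄) = (X ψ)̄`**: the Lie derivative along a real one-parameter group commutes with complex conjugation (Mathlib `deriv.star`,
no differentiability needed). [cite: BorelWallach2000, VII 2.10] -/
theorem lieDeriv_star (X : u21Group.lie) (ψ : GU → ℂ) :
    lieDeriv (H := u21Group) ιU X (fun y => star (ψ y)) = fun y => star (lieDeriv (H := u21Group) ιU X ψ y) := by
  funext g
  exact deriv.star

/-- Iterated form: `X₁ ⋯ Xₙ (ψ̄) = (X₁ ⋯ Xₙ ψ)̄`. [cite: BorelWallach2000, VII 2.10] -/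
theorem iterLieDeriv_star (w : List u21Group.lie) (ψ : GU → ℂ) :
    iterLieDeriv (H := u21Group) ιU w (fun y => star (ψ y)) = fun y => star (iterLieDeriv (H := u21Group) ιU w ψ y) := by
  induction w with
  | nil => rfl
  | cons X w ih => rw [iterLieDeriv_cons, iterLieDeriv_cons, ih, lieDeriv_star]

open scoped Matrix.Norms.Operator in
/-- Conjugation preserves smoothness in the archimedean variable (`conj` is a real-linear isometry, `Complex.conjCLE`).
[cite: BorelJacquetCorvallis1979, §4.1] -/
theorem isArchSmooth_star {ψ : GU → ℂ} (h : IsArchSmooth (H := u21Group) ιU ψ) :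
    IsArchSmooth (H := u21Group) ιU (fun y => star (ψ y)) := fun g => by
  have e : (fun X : u21Group.lie.toSubmodule => star (ψ (g * ιU (u21Group.expMem ⟨X, X.2⟩)))) =
      Complex.conjCLE ∘ fun X : u21Group.lie.toSubmodule => ψ (g * ιU (u21Group.expMem ⟨X, X.2⟩)) := by
    funext X
    rfl
  rw [e]
  exact Complex.conjCLE.contDiff.comp (h g)

end Star

variable {L : Type} [Field L] [NumberField L] [IsCMField L] (ι : L →+* ℂ) {H : Matrix (Fin 3) (Fin 3) L}
  (T : GL (Fin 3) ℂ) (hT : (T : Matrix (Fin 3) (Fin 3) ℂ)ᴴ * H.map ι * (T : Matrix (Fin 3) (Fin 3) ℂ) = J)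
  {μ : Measure (adelicGroupData (↥(maximalRealSubfield L)) L (IsCMField.complexConj L) 3 H).automorphicQuotient}
  {Φ : (adelicGroupData (↥(maximalRealSubfield L)) L (IsCMField.complexConj L) 3 H).Adelic → (Fin 2 → ℂ)}

/-- The coordinates of `Φ̄ = conjFun Φ` are the conjugates of those of `Φ`. [cite: BorelWallach2000, VII 2.10] -/
theorem conjFun_apply_coord (j : Fin 2) :
    (fun x => CotangentForms.conjFun (↥(maximalRealSubfield L)) L (IsCMField.complexConj L) 3 H Φ x j) = fun x => star (Φ x j) := by
  funext x
  rw [conjFun_apply, Pi.star_apply]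

/-- **The iterated Lie derivatives of the coordinates of `Φ̄` are the conjugates of those of `Φ`.** [cite: BorelWallach2000, VII 2.10] -/
theorem iterLieDeriv_conjFun (w : List u21Group.lie) (j : Fin 2) :
    iterLieDeriv (H := u21Group) (cmArchSection L ι H T hT) w (fun x => CotangentForms.conjFun (↥(maximalRealSubfield L)) L (IsCMField.complexConj L) 3 H Φ x j) =
      fun x => star (iterLieDeriv (H := u21Group) (cmArchSection L ι H T hT) w (fun x => Φ x j) x) := by
  rw [conjFun_apply_coord, iterLieDeriv_star]

/-- Every element of the conjugate span `S(Φ̄)` is the conjugate of an element of `S(Φ)`. [cite: BorelWallach2000, VII 2.10] -/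
theorem exists_eq_star_of_mem_span_conj {ψ : (adelicGroupData (↥(maximalRealSubfield L)) L (IsCMField.complexConj L) 3 H).Adelic → ℂ}
    (hψ : ψ ∈ Submodule.span ℂ (Set.range fun p : List u21Group.lie × Fin 2 =>
      iterLieDeriv (H := u21Group) (cmArchSection L ι H T hT) p.1 fun x => CotangentForms.conjFun (↥(maximalRealSubfield L)) L (IsCMField.complexConj L) 3 H Φ x p.2)) :
    ∃ ψ' ∈ Submodule.span ℂ (Set.range fun p : List u21Group.lie × Fin 2 =>
        iterLieDeriv (H := u21Group) (cmArchSection L ι H T hT) p.1 fun x => Φ x p.2),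
      ψ = fun x => star (ψ' x) := by
  induction hψ using Submodule.span_induction with
  | mem x hx =>
    obtain ⟨p, rfl⟩ := hx
    exact ⟨_, Submodule.subset_span ⟨p, rfl⟩, iterLieDeriv_conjFun ι T hT p.1 p.2⟩
  | zero => exact ⟨0, Submodule.zero_mem _, funext fun x => by simp⟩
  | add x y _ _ ihx ihy =>
    obtain ⟨x', hx', rfl⟩ := ihx
    obtain ⟨y', hy', rfl⟩ := ihy
    exact ⟨x' + y', Submodule.add_mem _ hx' hy', funext fun z => by simp [star_add]⟩
  | smul c x _ ihx =>
    obtain ⟨x', hx', rfl⟩ := ihx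
    exact ⟨star c • x', Submodule.smul_mem _ _ hx', funext fun z => by simp [star_mul']⟩

/-- The coordinates of `Φ̄` lie in `S(Φ̄)` (the empty word). [cite: BorelJacquetCorvallis1979, §1.5] -/
theorem conjFun_apply_mem_span_conj (j : Fin 2) :
    (fun x => CotangentForms.conjFun (↥(maximalRealSubfield L)) L (IsCMField.complexConj L) 3 H Φ x j) ∈ Submodule.span ℂ (Set.range fun p : List u21Group.lie × Fin 2 =>
      iterLieDeriv (H := u21Group) (cmArchSection L ι H T hT) p.1 fun x => CotangentForms.conjFun (↥(maximalRealSubfield L)) L (IsCMField.complexConj L) 3 H Φ x p.2) :=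
  Submodule.subset_span ⟨([], j), rfl⟩

variable [CompactSpace (adelicGroupData (↥(maximalRealSubfield L)) L (IsCMField.complexConj L) 3 H).automorphicQuotient] [(adelicGroupData (↥(maximalRealSubfield L)) L (IsCMField.complexConj L) 3 H).IsAutomorphicMeasure μ]

/-- **The conjugate span `S(Φ̄)` is an `L²`-LIE-STABLE space** for the local datum `(u21Group, cmArchSection)` (★ `IsL2LieStable`):
arch-smooth (conjugation), Lie-stable (`X` commutes with `star`), `L²`-representable and with injective class map (continuity and left
invariance pass to conjugates; ★ `F0P2aL2bHolLieSpanPackage`). [cite: HarishChandra1953, §7 (p. 209)] [cite: BorelJacquetCorvallis1979, §4.6] -/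
theorem isL2LieStable_span_conj
    (hΦ : Φ ∈ holCotForms (↥(maximalRealSubfield L)) L (IsCMField.complexConj L) 3 H (cmArchSection L ι H T hT)
      (cmCompactFactor L ι H T hT)) :
    IsL2LieStable
      ({ arch := u21Group, ofArch := cmArchSection L ι H T hT, continuous_ofArch := continuous_archSectionU21CM L ι H T hT,
           finiteAdelic := ⊥,
           commute_ofArch := fun g h hh => by rw [Subgroup.mem_bot] at hh; rw [hh, mul_one, one_mul],
           finiteLevels := {⊥}, finiteLevels_nonempty := Set.singleton_nonempty ⊥,
           le_finiteAdelic := fun U hU => le_of_eq (Set.mem_singleton_iff.1 hU), height := fun _ => 0 } :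
          AutomorphyDatum (adelicGroupData (↥(maximalRealSubfield L)) L (IsCMField.complexConj L) 3 H) ℂ (Fin 3)) μ
      (Submodule.span ℂ (Set.range fun p : List u21Group.lie × Fin 2 =>
        iterLieDeriv (H := u21Group) (cmArchSection L ι H T hT) p.1 fun x => CotangentForms.conjFun (↥(maximalRealSubfield L)) L (IsCMField.complexConj L) 3 H Φ x p.2)) := by
  obtain ⟨Kf, -, hR⟩ := span_iterLieDeriv_hol_regular hΦ
  -- arch-smoothness of the conjugate span
  have hsm : ∀ ψ ∈ Submodule.span ℂ (Set.range fun p : List u21Group.lie × Fin 2 =>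
      iterLieDeriv (H := u21Group) (cmArchSection L ι H T hT) p.1 fun x => CotangentForms.conjFun (↥(maximalRealSubfield L)) L (IsCMField.complexConj L) 3 H Φ x p.2),
      IsArchSmooth (H := u21Group) (cmArchSection L ι H T hT) ψ := by
    intro ψ hψ
    obtain ⟨ψ', hψ', rfl⟩ := exists_eq_star_of_mem_span_conj ι T hT hψ
    exact isArchSmooth_star _ (span_iterLieDeriv_hol_isArchSmooth hΦ hψ')
  -- continuity and left invariance of the conjugate span
  have hreg : ∀ ψ ∈ Submodule.span ℂ (Set.range fun p : List u21Group.lie × Fin 2 =>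
      iterLieDeriv (H := u21Group) (cmArchSection L ι H T hT) p.1 fun x => CotangentForms.conjFun (↥(maximalRealSubfield L)) L (IsCMField.complexConj L) 3 H Φ x p.2),
      Continuous ψ ∧ ∀ γ ∈ (adelicGroupData (↥(maximalRealSubfield L)) L (IsCMField.complexConj L) 3 H).quotientSubgroup, ∀ y, ψ (γ * y) = ψ y := by
    intro ψ hψ
    obtain ⟨ψ', hψ', rfl⟩ := exists_eq_star_of_mem_span_conj ι T hT hψ
    obtain ⟨hc, hl, -, -⟩ := hR ψ' hψ'
    exact ⟨hc.star, fun γ hγ y => by simp only [hl γ hγ y]⟩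
  refine ⟨hsm, fun X ψ hψ => ?_, fun ψ hψ => ?_, fun ψ hψ h0 => ?_⟩
  · -- Lie stability
    obtain ⟨ψ', hψ', rfl⟩ := exists_eq_star_of_mem_span_conj ι T hT hψ
    clear hψ
    obtain ⟨ψ'', hψ'', e⟩ : ∃ ψ'' ∈ Submodule.span ℂ (Set.range fun p : List u21Group.lie × Fin 2 =>
        iterLieDeriv (H := u21Group) (cmArchSection L ι H T hT) p.1 fun x => CotangentForms.conjFun (↥(maximalRealSubfield L)) L (IsCMField.complexConj L) 3 H Φ x p.2),
        ψ'' = fun x => star (lieDeriv (H := u21Group) (cmArchSection L ι H T hT) X ψ' x) := by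
      induction hψ' using Submodule.span_induction with
      | mem x hx =>
        obtain ⟨p, rfl⟩ := hx
        refine ⟨_, Submodule.subset_span ⟨(X :: p.1, p.2), rfl⟩, ?_⟩
        dsimp only
        rw [iterLieDeriv_cons, iterLieDeriv_conjFun, lieDeriv_star]
      | zero => exact ⟨0, Submodule.zero_mem _, funext fun x => by simp [lieDeriv_zero_right]⟩
      | add x y hx hy ihx ihy =>
        obtain ⟨x', hx', ex⟩ := ihx
        obtain ⟨y', hy', ey⟩ := ihy
        refine ⟨x' + y', Submodule.add_mem _ hx' hy', ?_⟩
        rw [IsArchSmooth.lieDeriv_add (H := u21Group) (cmArchSection L ι H T hT) X (span_iterLieDeriv_hol_isArchSmooth hΦ hx)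
          (span_iterLieDeriv_hol_isArchSmooth hΦ hy), ex, ey]
        funext z
        simp [star_add]
      | smul c x hx ihx =>
        obtain ⟨x', hx', ex⟩ := ihx
        refine ⟨star c • x', Submodule.smul_mem _ _ hx', ?_⟩
        rw [lieDeriv_smul, ex]
        funext z
        simp [star_mul']
    change lieDeriv (H := u21Group) (cmArchSection L ι H T hT) X (fun y => star (ψ' y)) ∈ _
    rw [lieDeriv_star, ← e]
    exact hψ''
  · -- `L²`-representability
    obtain ⟨hc, hl⟩ := hreg ψ hψ
    exact mem_l2Representable_of_continuous hl hc
  · -- injectivity of the class map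
    obtain ⟨hc, hl⟩ := hreg ψ hψ
    exact eq_zero_of_invQuot_eq_of_toLp_eq_zero hl hc _ ((adelicGroupData (↥(maximalRealSubfield L)) L (IsCMField.complexConj L) 3 H).memLp_l2Rep _) ((adelicGroupData (↥(maximalRealSubfield L)) L (IsCMField.complexConj L) 3 H).invQuot_l2Rep _) h0

/-- The coordinates of `Φ̄` have `L²` descents. [cite: BorelJacquetCorvallis1979, §4.6] -/
theorem memLp_toQuotFun_conjFun_apply
    (hΦ : Φ ∈ holCotForms (↥(maximalRealSubfield L)) L (IsCMField.complexConj L) 3 H (cmArchSection L ι H T hT)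
      (cmCompactFactor L ι H T hT)) (j : Fin 2) :
    MemLp (toQuotFun (adelicGroupData (↥(maximalRealSubfield L)) L (IsCMField.complexConj L) 3 H) fun x => CotangentForms.conjFun (↥(maximalRealSubfield L)) L (IsCMField.complexConj L) 3 H Φ x j) 2 μ :=
  memLp_toQuotFun_of_mem ι T hT (isL2LieStable_span_conj ι T hT hΦ) (conjFun_apply_mem_span_conj ι T hT j)

/-! ## §2 The conjugate `K`-type and the anti-Cauchy–Riemann relations of `Φ̄` -/

omit [CompactSpace (adelicGroupData (↥(maximalRealSubfield L)) L (IsCMField.complexConj L) 3 H).automorphicQuotient] [(adelicGroupData (↥(maximalRealSubfield L)) L (IsCMField.complexConj L) 3 H).IsAutomorphicMeasure μ] in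
/-- **The CONJUGATE cotangent `K`-type of `Φ̄`**: `Φ̄ (x · ι_∞ k) j = ∑ᵢ conj(conj(k₂₂) kᵢⱼ) · Φ̄ x i` (★ `apply_mul_cmArchSectionUForm_K`,
conjugated). [cite: BorelWallach2000, VI 4.8] -/
theorem apply_mul_cmArchSectionUForm_K_conj
    (hΦ : Φ ∈ holCotForms (↥(maximalRealSubfield L)) L (IsCMField.complexConj L) 3 H (cmArchSection L ι H T hT)
      (cmCompactFactor L ι H T hT))
    (k : (uFormGroup (Fin 2) (Fin 1)).maximalCompact) (x : (adelicGroupData (↥(maximalRealSubfield L)) L (IsCMField.complexConj L) 3 H).Adelic) (j : Fin 2) :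
    CotangentForms.conjFun (↥(maximalRealSubfield L)) L (IsCMField.complexConj L) 3 H Φ (x * cmArchSectionUForm L ι H T hT (Subgroup.inclusion (uFormGroup (Fin 2) (Fin 1)).maximalCompact_le_carrier k)) j =
      ∑ i : Fin 2, (starRingEnd ℂ) ((starRingEnd ℂ) (((k : GL (Fin 2 ⊕ Fin 1) ℂ) : Matrix (Fin 2 ⊕ Fin 1) (Fin 2 ⊕ Fin 1) ℂ)
        (Sum.inr 0) (Sum.inr 0)) * ((k : GL (Fin 2 ⊕ Fin 1) ℂ) : Matrix (Fin 2 ⊕ Fin 1) (Fin 2 ⊕ Fin 1) ℂ) (Sum.inl i) (Sum.inl j)) *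
        CotangentForms.conjFun (↥(maximalRealSubfield L)) L (IsCMField.complexConj L) 3 H Φ x i := by
  rw [conjFun_apply, Pi.star_apply, apply_mul_cmArchSectionUForm_K L ι H T hT hΦ k x j, Complex.star_def, map_sum]
  refine Finset.sum_congr rfl fun i _ => ?_
  rw [map_mul, conjFun_apply, Pi.star_apply, Complex.star_def]

omit [CompactSpace (adelicGroupData (↥(maximalRealSubfield L)) L (IsCMField.complexConj L) 3 H).automorphicQuotient] [(adelicGroupData (↥(maximalRealSubfield L)) L (IsCMField.complexConj L) 3 H).IsAutomorphicMeasure μ] in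
/-- **Anti-Cauchy–Riemann along `𝔭` for the coordinates of `Φ̄`**: `X_{ib} Φ̄ⱼ = −i · X_b Φ̄ⱼ` pointwise (conjugate of ★
`lieDeriv_liePMat_I_smul_hol`). [cite: Borel1997, §5.14] [cite: BorelWallach2000, VII 2.10] -/
theorem lieDeriv_liePMat_I_smul_antihol
    (hΦ : Φ ∈ holCotForms (↥(maximalRealSubfield L)) L (IsCMField.complexConj L) 3 H (cmArchSection L ι H T hT)
      (cmCompactFactor L ι H T hT)) (b : Fin 2 → ℂ) (j : Fin 2) (x : (adelicGroupData (↥(maximalRealSubfield L)) L (IsCMField.complexConj L) 3 H).Adelic) :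
    lieDeriv (H := u21Group) (cmArchSection L ι H T hT) (liePMat (Complex.I • b)) (fun y => CotangentForms.conjFun (↥(maximalRealSubfield L)) L (IsCMField.complexConj L) 3 H Φ y j) x =
      (-Complex.I) * lieDeriv (H := u21Group) (cmArchSection L ι H T hT) (liePMat b) (fun y => CotangentForms.conjFun (↥(maximalRealSubfield L)) L (IsCMField.complexConj L) 3 H Φ y j) x := by
  rw [conjFun_apply_coord, lieDeriv_star, lieDeriv_star]
  dsimp only
  rw [lieDeriv_liePMat_I_smul_hol ι T hT hΦ b j x, star_mul', Complex.star_def, Complex.conj_I]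

/-! ## §3 HEAD: the value map of an antiholomorphic cotangent form -/

variable (P : DiscreteAutomorphicRep (adelicGroupData (↥(maximalRealSubfield L)) L (IsCMField.complexConj L) 3 H) μ)

/-- The two coordinate classes of `Φ̄ = conjFun Φ` with classes in `P`, as elements of `P.archModuleCM ι T hT` (`W = S(Φ̄)`,
`isL2LieStable_span_conj`; conjugate `K`-type). [cite: BorelWallach2000, Ch. 0 §2.4 (p. 3)] -/
theorem exists_vectors_antihol
    (hΦ : Φ ∈ holCotForms (↥(maximalRealSubfield L)) L (IsCMField.complexConj L) 3 H (cmArchSection L ι H T hT)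
      (cmCompactFactor L ι H T hT))
    (hP : ∀ j : Fin 2, (memLp_toQuotFun_conjFun_apply ι T hT (μ := μ) hΦ j).toLp _ ∈ P.space.toSubmodule) :
    ∃ w : Fin 2 → P.archModuleCM ι T hT,
      ∀ j : Fin 2, (((w j : P.archModuleCM ι T hT) : P.space.toSubmodule) : (adelicGroupData (↥(maximalRealSubfield L)) L (IsCMField.complexConj L) 3 H).L2 μ) =
        (memLp_toQuotFun_conjFun_apply ι T hT (μ := μ) hΦ j).toLp (toQuotFun (adelicGroupData (↥(maximalRealSubfield L)) L (IsCMField.complexConj L) 3 H) fun x => CotangentForms.conjFun (↥(maximalRealSubfield L)) L (IsCMField.complexConj L) 3 H Φ x j) :=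
  exists_vectors_of ι T hT (isL2LieStable_span_conj ι T hT hΦ) P (conjFun_apply_mem_span_conj ι T hT)
    (fun k j i => (starRingEnd ℂ) ((starRingEnd ℂ) (((k : GL (Fin 2 ⊕ Fin 1) ℂ) : Matrix (Fin 2 ⊕ Fin 1) (Fin 2 ⊕ Fin 1) ℂ)
      (Sum.inr 0) (Sum.inr 0)) * ((k : GL (Fin 2 ⊕ Fin 1) ℂ) : Matrix (Fin 2 ⊕ Fin 1) (Fin 2 ⊕ Fin 1) ℂ) (Sum.inl i) (Sum.inl j)))
    (fun k x j => apply_mul_cmArchSectionUForm_K_conj ι T hT hΦ k x j) hP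

/-- **B1′ (antiholomorphic twin) — THE VALUE MAP OF `Φ̄ = conjFun Φ` IS A TYPED NULL VALUE MAP OF TYPE `−1`.**  For `Φ ∈ holCotForms` of the
CM frame with the coordinate classes of `Φ̄` in `P` (`P.ContainsForm Φ̄`), the classes `w₀, w₁ ∈ P.archModuleCM ι T hT`
(`exists_vectors_antihol`) and the CONJUGATE-LINEAR value map `φ(Y) = ∑ⱼ conj(Y_{(inl j)(inr 0)}) • wⱼ` (★ `exists_valueMap` with `χ = conj`):
for `(ρK, ρ𝔤) = (P.archRepKCM ι T hT, P.archRepLieCM ι T hT)`, (h0) `φ(𝔨) = 0`; (hK) `ρK(k) φ(Y) = φ(Ad(k) Y)`; (h𝔨) `φ(⁅W, Y⁆) = ρ𝔤(W) φ(Y)`,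
`W ∈ 𝔨`; (hwt) `ρ𝔤(z₀) φ(Y) = −i • φ(Y)`; (hN) `ρ𝔤(x_s) φ(Y) + (−i) • ρ𝔤(⁅z₀, x_s⁆) φ(Y) = 0` — the `φm` binders `hm0 … hmN` of ★
`F0P3ValueMapTransport.not_both_types_of_detected` at `(α, β) = (Fin 2, Fin 1)`, token for token — and `Φ̄ ≠ 0 → φ ≠ 0`.
[cite: BorelWallach2000, II §4.1–4.2, VI 4.8 and VII 2.10] [cite: Rogawski1990, Prop. 15.2.1 (b)] [cite: BorelJacquetCorvallis1979, §4.6] -/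
theorem valueMap_antihol
    (hΦ : Φ ∈ holCotForms (↥(maximalRealSubfield L)) L (IsCMField.complexConj L) 3 H (cmArchSection L ι H T hT)
      (cmCompactFactor L ι H T hT)) (w : Fin 2 → P.archModuleCM ι T hT)
    (hw : ∀ j : Fin 2, (((w j : P.archModuleCM ι T hT) : P.space.toSubmodule) : (adelicGroupData (↥(maximalRealSubfield L)) L (IsCMField.complexConj L) 3 H).L2 μ) =
      (memLp_toQuotFun_conjFun_apply ι T hT (μ := μ) hΦ j).toLp (toQuotFun (adelicGroupData (↥(maximalRealSubfield L)) L (IsCMField.complexConj L) 3 H) fun x => CotangentForms.conjFun (↥(maximalRealSubfield L)) L (IsCMField.complexConj L) 3 H Φ x j))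
    (φ : (uFormGroup (Fin 2) (Fin 1)).lie →ₗ[ℝ] P.archModuleCM ι T hT)
    (hφ : ∀ Y : (uFormGroup (Fin 2) (Fin 1)).lie,
      φ Y = ∑ j : Fin 2, (starRingEnd ℂ) ((Y : Matrix (Fin 2 ⊕ Fin 1) (Fin 2 ⊕ Fin 1) ℂ) (Sum.inl j) (Sum.inr 0)) • w j) :
    (∀ W ∈ (uFormGroup (Fin 2) (Fin 1)).kInLie, φ W = 0) ∧
    (∀ (k : (uFormGroup (Fin 2) (Fin 1)).maximalCompact) (X : (uFormGroup (Fin 2) (Fin 1)).lie),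
      P.archRepKCM ι T hT k (φ X) = φ ((uFormGroup (Fin 2) (Fin 1)).Ad
        (Subgroup.inclusion (uFormGroup (Fin 2) (Fin 1)).maximalCompact_le_carrier k) X)) ∧
    (∀ W ∈ (uFormGroup (Fin 2) (Fin 1)).kInLie, ∀ X : (uFormGroup (Fin 2) (Fin 1)).lie,
      φ ⁅W, X⁆ = P.archRepLieCM ι T hT W (φ X)) ∧
    (∀ X : (uFormGroup (Fin 2) (Fin 1)).lie, P.archRepLieCM ι T hT (upqZ0 (Fin 2) (Fin 1)) (φ X) = (-Complex.I) • φ X) ∧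
    (∀ (X : (uFormGroup (Fin 2) (Fin 1)).lie) (s : (Fin 2 × Fin 1) × Fin 2),
      P.archRepLieCM ι T hT (upqPBasis s) (φ X) +
        (-Complex.I) • P.archRepLieCM ι T hT ⁅upqZ0 (Fin 2) (Fin 1), upqPBasis s⁆ (φ X) = 0) ∧
    (CotangentForms.conjFun (↥(maximalRealSubfield L)) L (IsCMField.complexConj L) 3 H Φ ≠ 0 → φ ≠ 0) := by
  have hW' := isL2LieStable_span_conj ι T hT (μ := μ) hΦ
  have hWΨ := conjFun_apply_mem_span_conj ι T hT (Φ := Φ)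
  have h5 := F0P3ValueMapOfFrameVectors.valueMap_antihol (P.archRepKCM ι T hT) (P.archRepLieCM ι T hT)
    (P.isGKModule_archModuleCM ι T hT) w
    (archRepKCM_eq_sum_of ι T hT hW' P hWΨ _ (fun k x j => apply_mul_cmArchSectionUForm_K_conj ι T hT hΦ k x j) w hw)
    (fun p c j => archRepLieCM_upqUnit_I_mul_of ι T hT hW' P hWΨ (-Complex.I) (lieDeriv_liePMat_I_smul_antihol ι T hT hΦ) (hw j) p c)
    φ hφ
  refine ⟨h5.1, h5.2.1, h5.2.2.1, h5.2.2.2.1, h5.2.2.2.2, fun hΦ0 hφ0 => hΦ0 ?_⟩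
  -- nonvanishing: `φ = 0` forces `[Φ̄ⱼ] = 0`, hence `Φ̄ⱼ = 0`, for both `j`
  have hφ' : ∀ Y : (uFormGroup (Fin 2) (Fin 1)).lie, φ Y = ∑ j : Fin 2,
      Complex.conjLIE.toLinearEquiv.toLinearMap ((Y : Matrix (Fin 2 ⊕ Fin 1) (Fin 2 ⊕ Fin 1) ℂ) (Sum.inl j) (Sum.inr 0)) • w j := hφ
  have hχ : Complex.conjLIE.toLinearEquiv.toLinearMap (1 : ℂ) ≠ 0 := by
    show (starRingEnd ℂ) 1 ≠ 0
    rw [map_one]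
    exact one_ne_zero
  have hw0 := (valueMap_eq_zero_iff _ hχ w φ hφ').1 hφ0
  funext x j
  have hj : (fun x => CotangentForms.conjFun (↥(maximalRealSubfield L)) L (IsCMField.complexConj L) 3 H Φ x j) = 0 := by
    rw [← toLp_eq_zero_iff_of_mem ι T hT hW' (hWΨ j), ← hw j, hw0 j]
    rfl
  exact congrFun hj x

end Summit.HodgeConjecture.HodgeConjecture.Cruxes.H413.F0P3CotangentFormValueMapAntihol

end
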